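import Summits.HubbardSuperconductivity.HubbardSuperconductivity.Theses.PlaquetteBoson
import Summits.AtomisticToContinuum.BoseEinsteinCondensation.Theorems.BECStronglyRayleighGroundStateStabilitySectorPerron
import Literature.MathematicalPhysics.QuantumLattice.SpinChainsLiebMattisProofs

/-!
# Route `PlaquetteBoson`, support `PbParticleHole` (stmt-HubbardSuperconductivity-1029)

Exact particle–hole symmetry of the hard-core lattice gas = global spin flip of the `S = ½` XXZ
model. For every anisotropy `Δ`, every side `M` and every magnetisation `Mag`, a normalised
sector ground state `ψ` of `H = xxzHamiltonian 1 (torusGraph 2 M) (−1) Δ` in the sector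
`S^z_tot = Mag` yields a normalised sector ground state `ψ' := ψ ∘ F` of the sector
`S^z_tot = −Mag` (`F` the configuration flip `σ_x ↦ 1 − σ_x`) with
`⟨ψ', S⁺_tot S⁻_tot ψ'⟩ = ⟨ψ, S⁺_tot S⁻_tot ψ⟩ − 2 Mag`.

Proof: in the `S^z` basis the entries of `H` are flip invariant (the diagonal
`(1 − Δ) Σ_{xy} (½ − σ_x)(½ − σ_y)` part of `leadPF_ham_eq` is even, and the entries of the
Heisenberg exchange — diagonal `(½ − σ_x)(½ − σ_y)`, off-diagonal
`½(S⁺_{σ_xτ_x} S⁻_{σ_yτ_y} + S⁻_{σ_xτ_x} S⁺_{σ_yτ_y})` — are exchanged termwise since the flip swaps the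
entries of `S⁺` and `S⁻`), so `H(ψ ∘ F) = (Hψ) ∘ F`; the flip negates the magnetisation, preserves
norms and Rayleigh quotients, hence maps sector ground states to sector ground states and
`E(Mag) = E(−Mag)`; finally `F S^± F = S^∓` entrywise gives
`⟨ψ∘F, S⁺S⁻ (ψ∘F)⟩ = ⟨ψ, S⁻S⁺ ψ⟩ = ⟨ψ, S⁺S⁻ ψ⟩ − 2⟨ψ, S^z ψ⟩` by `[S⁺, S⁻] = 2 S^z`.

Sources: H. Tasaki, *Physics and Mathematics of Quantum Many-Body Systems* (2020), §2.2, §2.4;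
E. Lieb, D. Mattis, J. Math. Phys. 3 (1962) 749. No definition is introduced (the flip is a local
`fun`).
-/

set_option linter.dupNamespace false

noncomputable section

namespace Summit.HubbardSuperconductivity.HubbardSuperconductivity.Theorems.PlaquetteBoson

open scoped BigOperators Matrix ComplexOrder
open Matrix Complex Finset
open Literature.MathematicalPhysics.QuantumLattice Literature.Probability.LatticeModels
open Summit.HubbardSuperconductivity.HubbardSuperconductivity.Theses.PlaquetteBoson
open Summit.AtomisticToContinuum.BoseEinsteinCondensation.Cruxes.GroundStateStability.StableConeVariationalSelection

section Flip

variable {Λ : Type*} [Fintype Λ] [DecidableEq Λ]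

/-! ### The configuration flip `σ_x ↦ 1 − σ_x` -/

/-- The flip `Fin.rev` of a spin-½ label negates `½ − σ` (complex form). [folklore] -/
private theorem half_sub_rev (k : Fin 2) :
    ((1 : ℂ) / 2 - ((k.rev : ℕ) : ℂ)) = -((1 : ℂ) / 2 - ((k : ℕ) : ℂ)) := by
  fin_cases k <;> norm_num

/-- The flip `Fin.rev` of a spin-½ label negates `½ − σ` (real form). [folklore] -/
private theorem half_sub_rev_real (k : Fin 2) :
    ((1 : ℝ) / 2 - ((k.rev : ℕ) : ℝ)) = -((1 : ℝ) / 2 - ((k : ℕ) : ℝ)) := by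
  fin_cases k <;> norm_num

/-- The flip exchanges the entries of `S⁺` and `S⁻` (spin ½). [folklore] -/
private theorem spinRaise_rev (k l : Fin 2) : spinRaise 1 k.rev l.rev = spinLower 1 k l := by
  rw [spinRaise_apply, spinLower_apply]
  fin_cases k <;> fin_cases l <;> norm_num

/-- The flip exchanges the entries of `S⁻` and `S⁺` (spin ½). [folklore] -/
private theorem spinLower_rev (k l : Fin 2) : spinLower 1 k.rev l.rev = spinRaise 1 k l := by
  rw [← spinRaise_rev, Fin.rev_rev, Fin.rev_rev]

omit [Fintype Λ] [DecidableEq Λ] in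
/-- The configuration flip is an involution. [folklore] -/
private theorem flip_flip (σ : TensorIndex Λ 2) :
    (fun x => ((fun x => (σ x).rev : TensorIndex Λ 2) x).rev : TensorIndex Λ 2) = σ := by
  funext x; exact Fin.rev_rev _

/-- Reindexing a sum over configurations by the flip. [folklore] -/
private theorem sum_flip {β : Type*} [AddCommMonoid β] (g : TensorIndex Λ 2 → β) :
    (∑ σ : TensorIndex Λ 2, g (fun x => (σ x).rev)) = ∑ σ, g σ :=
  Equiv.sum_comp (Function.Involutive.toPerm (fun σ : TensorIndex Λ 2 => fun x => (σ x).rev)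
    (fun σ => flip_flip σ)) g

/-- **Transport of a matrix along the flip.** If `B (Fσ) (Fτ) = A σ τ` for all `σ, τ`, then
`A (ψ ∘ F) = (B ψ) ∘ F`. [folklore] -/
private theorem mulVec_flip {A B : Op Λ 2}
    (hAB : ∀ σ τ : TensorIndex Λ 2, B (fun x => (σ x).rev) (fun x => (τ x).rev) = A σ τ)
    (ψ : TensorIndex Λ 2 → ℂ) (σ : TensorIndex Λ 2) :
    (A *ᵥ fun τ => ψ (fun x => (τ x).rev)) σ = (B *ᵥ ψ) (fun x => (σ x).rev) := by
  simp only [Matrix.mulVec, dotProduct]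
  rw [← sum_flip (fun τ => B (fun x => (σ x).rev) τ * ψ τ)]
  refine Finset.sum_congr rfl fun τ _ => ?_
  rw [hAB]

/-! ### Flip invariance of the XXZ Hamiltonian -/

/-- The Heisenberg exchange `𝐒_x · 𝐒_y` (`x ≠ y`) has flip-invariant entries. [folklore] -/
private theorem spinDot_flip {x y : Λ} (hxy : x ≠ y) (σ τ : TensorIndex Λ 2) :
    spinDot 1 x y (fun z => (σ z).rev) (fun z => (τ z).rev) = spinDot 1 x y σ τ := by
  by_cases hστ : σ = τ
  · subst hστ
    rw [LiebMattis.spinDot_apply_self 1 hxy, LiebMattis.spinDot_apply_self 1 hxy]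
    push_cast
    rw [half_sub_rev, half_sub_rev, neg_mul_neg]
  · have hστ' : (fun z => (σ z).rev : TensorIndex Λ 2) ≠ fun z => (τ z).rev := by
      intro h
      apply hστ
      funext z
      exact Fin.rev_inj.1 (congrFun h z)
    rw [LiebMattis.spinDot_apply_of_ne 1 hxy hστ', LiebMattis.spinDot_apply_of_ne 1 hxy hστ]
    simp only [spinRaise_rev, spinLower_rev]
    have hc : (∀ z, z ≠ x → z ≠ y → (σ z).rev = (τ z).rev) ↔ (∀ z, z ≠ x → z ≠ y → σ z = τ z) := by
      simp only [Fin.rev_inj]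
    simp only [hc, add_comm (spinLower 1 (σ x) (τ x) * spinRaise 1 (σ y) (τ y))]

/-- The Heisenberg Hamiltonian has flip-invariant entries. [folklore] -/
private theorem heisenberg_flip (G : SimpleGraph Λ) [DecidableRel G.Adj] (σ τ : TensorIndex Λ 2) :
    heisenbergHamiltonian 1 G 1 (fun z => (σ z).rev) (fun z => (τ z).rev) =
      heisenbergHamiltonian 1 G 1 σ τ := by
  rw [LiebMattis.heisenbergHamiltonian_apply, LiebMattis.heisenbergHamiltonian_apply]
  congr 1
  refine Finset.sum_congr rfl fun e he => ?_
  revert he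
  induction e using Sym2.ind with
  | h x y =>
    intro he
    rw [SimpleGraph.mem_edgeFinset, SimpleGraph.mem_edgeSet] at he
    exact spinDot_flip he.ne σ τ

/-- **The XXZ Hamiltonian (hard-core sign, any `Δ`) has flip-invariant entries.** [folklore] -/
theorem xxz_flip (G : SimpleGraph Λ) [DecidableRel G.Adj] (Δ : ℝ) (σ τ : TensorIndex Λ 2) :
    xxzHamiltonian 1 G (-1) Δ (fun z => (σ z).rev) (fun z => (τ z).rev) =
      xxzHamiltonian 1 G (-1) Δ σ τ := by
  have h := leadPF_ham_eq G Δ (fun _ => (0 : ℝ))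
  simp only [Complex.ofReal_zero, zero_smul, Finset.sum_const_zero, add_zero, zero_mul] at h
  rw [h, Matrix.add_apply, Matrix.add_apply, Matrix.neg_apply, Matrix.neg_apply, heisenberg_flip]
  congr 1
  by_cases hστ : σ = τ
  · subst hστ
    rw [diagonal_apply_eq, diagonal_apply_eq]
    congr 2
    refine Finset.sum_congr rfl fun e _ => ?_
    induction e using Sym2.ind with
    | h x y =>
      simp only [Sym2.lift_mk]
      rw [half_sub_rev_real, half_sub_rev_real, neg_mul_neg]
  · have hστ' : (fun z => (σ z).rev : TensorIndex Λ 2) ≠ fun z => (τ z).rev := by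
      intro h'
      apply hστ
      funext z
      exact Fin.rev_inj.1 (congrFun h' z)
    rw [diagonal_apply_ne _ hστ', diagonal_apply_ne _ hστ]

/-! ### Flip of the ladder operators: `F S⁺ F = S⁻` -/

/-- Entries: `S⁺_tot (Fσ)(Fτ) = S⁻_tot σ τ`. [folklore] -/
private theorem raiseOn_flip (σ τ : TensorIndex Λ 2) :
    raiseOn 1 (Finset.univ : Finset Λ) (fun z => (σ z).rev) (fun z => (τ z).rev) =
      lowerOn 1 Finset.univ σ τ := by
  rw [raiseOn, lowerOn, Matrix.sum_apply, Matrix.sum_apply]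
  refine Finset.sum_congr rfl fun x _ => ?_
  rw [onSite_apply, onSite_apply]
  have hc : (∀ y, y ≠ x → (σ y).rev = (τ y).rev) ↔ (∀ y, y ≠ x → σ y = τ y) := by
    simp only [Fin.rev_inj]
  simp only [hc, spinRaise_rev]

/-- Entries: `S⁻_tot (Fσ)(Fτ) = S⁺_tot σ τ`. [folklore] -/
private theorem lowerOn_flip (σ τ : TensorIndex Λ 2) :
    lowerOn 1 (Finset.univ : Finset Λ) (fun z => (σ z).rev) (fun z => (τ z).rev) =
      raiseOn 1 Finset.univ σ τ := by
  rw [raiseOn, lowerOn, Matrix.sum_apply, Matrix.sum_apply]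
  refine Finset.sum_congr rfl fun x _ => ?_
  rw [onSite_apply, onSite_apply]
  have hc : (∀ y, y ≠ x → (σ y).rev = (τ y).rev) ↔ (∀ y, y ≠ x → σ y = τ y) := by
    simp only [Fin.rev_inj]
  simp only [hc, spinLower_rev]

/-- Entries: `(S⁻S⁺)(Fσ)(Fτ) = (S⁺S⁻) σ τ`. [folklore] -/
private theorem lowerRaise_flip (σ τ : TensorIndex Λ 2) :
    (lowerOn 1 (Finset.univ : Finset Λ) * raiseOn 1 Finset.univ : Op Λ 2) (fun z => (σ z).rev)
        (fun z => (τ z).rev) =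
      (raiseOn 1 (Finset.univ : Finset Λ) * lowerOn 1 Finset.univ : Op Λ 2) σ τ := by
  rw [Matrix.mul_apply, Matrix.mul_apply,
    ← sum_flip (fun ρ => (lowerOn 1 (Finset.univ : Finset Λ) : Op Λ 2) (fun z => (σ z).rev) ρ *
      (raiseOn 1 (Finset.univ : Finset Λ) : Op Λ 2) ρ (fun z => (τ z).rev))]
  refine Finset.sum_congr rfl fun ρ _ => ?_
  rw [raiseOn_flip, lowerOn_flip]

/-! ### The flipped state -/

/-- The flip negates the magnetisation of a sector. [folklore] -/
private theorem flip_mem_spinZSector {Mag : ℝ} {ψ : TensorIndex Λ 2 → ℂ}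
    (hψ : ψ ∈ spinZSector (Λ := Λ) 1 Mag) :
    (fun σ => ψ (fun x => (σ x).rev) : TensorIndex Λ 2 → ℂ) ∈ spinZSector (Λ := Λ) 1 (-Mag) := by
  rw [LiebMattis.mem_spinZSector_iff] at hψ ⊢
  intro σ hσ
  have h := hψ _ hσ
  simp only [Nat.cast_one] at h ⊢
  have h' : (∑ x, ((1 : ℂ) / 2 - (((σ x).rev : ℕ) : ℂ))) = -∑ x, ((1 : ℂ) / 2 - ((σ x : ℕ) : ℂ)) := by
    rw [← Finset.sum_neg_distrib]
    exact Finset.sum_congr rfl fun x _ => half_sub_rev (σ x)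
  rw [h'] at h
  rw [Complex.ofReal_neg, ← h, neg_neg]

/-- The flip preserves inner products `⟨ψ∘F, (Bχ)∘F⟩ = ⟨ψ, Bχ⟩`-style sums: for any `g`,
`Σ_σ conj(ψ(Fσ)) g(Fσ) = Σ_σ conj(ψ σ) g σ`. [folklore] -/
private theorem dot_flip (ψ g : TensorIndex Λ 2 → ℂ) :
    (star (fun σ => ψ (fun x => (σ x).rev) : TensorIndex Λ 2 → ℂ) ⬝ᵥ fun σ => g (fun x => (σ x).rev)) =
      star ψ ⬝ᵥ g := by
  simp only [dotProduct, Pi.star_apply]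
  exact sum_flip (fun σ => star (ψ σ) * g σ)

/-- **Sector energies are flip symmetric**: `E(−Mag) = E(Mag)` for the XXZ Hamiltonian.
[folklore] -/
private theorem lowestEnergyInSector_neg (G : SimpleGraph Λ) [DecidableRel G.Adj] (Δ Mag : ℝ) :
    lowestEnergyInSector 1 (xxzHamiltonian 1 G (-1) Δ) (-Mag) =
      lowestEnergyInSector 1 (xxzHamiltonian 1 G (-1) Δ) Mag := by
  -- the Rayleigh sets of the two sectors coincide
  have key : ∀ M' : ℝ, {E : ℝ | ∃ ψ ∈ spinZSector (Λ := Λ) 1 M', star ψ ⬝ᵥ ψ = 1 ∧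
      E = (star ψ ⬝ᵥ xxzHamiltonian 1 G (-1) Δ *ᵥ ψ).re} ⊆
      {E : ℝ | ∃ ψ ∈ spinZSector (Λ := Λ) 1 (-M'), star ψ ⬝ᵥ ψ = 1 ∧
      E = (star ψ ⬝ᵥ xxzHamiltonian 1 G (-1) Δ *ᵥ ψ).re} := by
    intro M' E hE
    obtain ⟨ψ, hψK, hψ1, hE⟩ := hE
    refine ⟨fun σ => ψ (fun x => (σ x).rev), flip_mem_spinZSector hψK, ?_, ?_⟩
    · rw [dot_flip, hψ1]
    · have h : (xxzHamiltonian 1 G (-1) Δ *ᵥ fun τ => ψ (fun x => (τ x).rev)) =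
          fun σ => (xxzHamiltonian 1 G (-1) Δ *ᵥ ψ) (fun x => (σ x).rev) :=
        funext fun σ => mulVec_flip (xxz_flip G Δ) ψ σ
      rw [hE, h, dot_flip]
  unfold lowestEnergyInSector Matrix.minEnergyOn
  congr 1
  refine Set.Subset.antisymm ?_ (key Mag)
  have h := key (-Mag)
  rwa [neg_neg] at h

end Flip

/-- **`PbParticleHole` holds** (route `PlaquetteBoson`, item `stmt-HubbardSuperconductivity-1029`):
the global spin flip `ψ ↦ ψ ∘ F` maps normalised `S^z_tot = Mag` sector ground states of the XXZ
torus (any `Δ`) to normalised `S^z_tot = −Mag` sector ground states, with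
`⟨ψ∘F, S⁺S⁻ (ψ∘F)⟩ = ⟨ψ, S⁻S⁺ ψ⟩ = ⟨ψ, S⁺S⁻ ψ⟩ − 2 Mag`. Tasaki (2020) §2.2, §2.4; Lieb–Mattis (1962).
[folklore] -/
theorem pbParticleHole_proof : PbParticleHole := by
  unfold PbParticleHole
  intro Δ M _ Mag ψ hψK hψ1 hHψ
  set H : Op (TorusSite 2 M) 2 := xxzHamiltonian 1 (torusGraph 2 M) (-1) Δ with hHdef
  refine ⟨fun σ => ψ (fun x => (σ x).rev), flip_mem_spinZSector hψK, ?_, ?_, ?_⟩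
  · rw [dot_flip, hψ1]
  · have h : (H *ᵥ fun τ => ψ (fun x => (τ x).rev)) = fun σ => (H *ᵥ ψ) (fun x => (σ x).rev) :=
      funext fun σ => mulVec_flip (xxz_flip (torusGraph 2 M) Δ) ψ σ
    rw [h, hHψ, lowestEnergyInSector_neg]
    rfl
  · -- `⟨ψ∘F, S⁺S⁻ (ψ∘F)⟩ = ⟨ψ, S⁻S⁺ ψ⟩ = ⟨ψ, S⁺S⁻ ψ⟩ − 2 Mag`
    show (star (fun σ : TensorIndex (TorusSite 2 M) 2 => ψ (fun x => (σ x).rev)) ⬝ᵥ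
      (raiseOn 1 Finset.univ * lowerOn 1 Finset.univ : Op (TorusSite 2 M) 2) *ᵥ
        fun σ : TensorIndex (TorusSite 2 M) 2 => ψ (fun x => (σ x).rev)).re =
      (star ψ ⬝ᵥ (raiseOn 1 Finset.univ * lowerOn 1 Finset.univ : Op (TorusSite 2 M) 2) *ᵥ ψ).re -
        2 * Mag
    have h : ((raiseOn 1 Finset.univ * lowerOn 1 Finset.univ : Op (TorusSite 2 M) 2) *ᵥ
        fun τ : TensorIndex (TorusSite 2 M) 2 => ψ (fun x => (τ x).rev)) =
        fun σ => ((lowerOn 1 Finset.univ * raiseOn 1 Finset.univ : Op (TorusSite 2 M) 2) *ᵥ ψ)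
          (fun x => (σ x).rev) :=
      funext fun σ => mulVec_flip lowerRaise_flip ψ σ
    rw [h, dot_flip]
    have hsu2 := isSu2Triple_on 1 (Finset.univ : Finset (TorusSite 2 M))
    have hLR : lowerOn 1 (Finset.univ : Finset (TorusSite 2 M)) * raiseOn 1 Finset.univ =
        raiseOn 1 Finset.univ * lowerOn 1 Finset.univ - (2 : ℂ) • zOn 1 Finset.univ := by
      rw [← hsu2.comm_PM]; abel
    have hZ : zOn 1 Finset.univ *ᵥ ψ = (Mag : ℂ) • ψ := (mem_spinZSector_iff_mulVec 1 Mag ψ).1 hψK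
    rw [hLR, sub_mulVec, Matrix.smul_mulVec, hZ, dotProduct_sub, dotProduct_smul, dotProduct_smul,
      hψ1, Complex.sub_re]
    simp

end Summit.HubbardSuperconductivity.HubbardSuperconductivity.Theorems.PlaquetteBoson
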